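import Summits.QuantumFields.GaugeBoot.TruncatedRightRows
import Summits.QuantumFields.GaugeBoot.BootstrapReflections
import Summits.QuantumFields.GaugeBoot.OrbitAverages
import HarnessLib

/-!
# Reflection cuts at level `n` cost at most two levels: `levelValues_{n+2} ⊆ reflection-symmetric levelValues_n ⊆ levelValues_n` (gauge-boot, L1/L4 supplement)

HONEST FRAMING (cell `pub-gaugeboot`, page 1 of every file): the venture produces certified bounds
on lattice expectations at stated coupling, gauge group, dimension and torus size; NOT a mass gap,
NOT a continuum limit, NOT a string tension; NOT Yang–Mills-summit-bearing (barriers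
`FixedCouplingUltralocality`, `PerturbativeInvisibility`). Structural; it certifies no number.

## Content

`BootstrapSymmetryReduction` proved that translation/axis-permutation invariance imposed at fixed
level is LOSSLESS, and left the site REFLECTION `Θ'` open: an orientation-reversing map turns the
left one-link shifts of the reversed links into right shifts, whose loop equations at word level `n`
need left loop equations at level `n + 2` (`TruncatedRightRows`). Quantitatively:

* `comp_negReflectCM_mem_wordTruncation` — `V_n ∘ Θ' ⊆ V_n` (a reversed link contributes
  `ρ(U⁻¹) = ρ(U)ᴴ`: generators go to `±` generators);
* ★★ `IsBootstrapFeasible.comp_negReflect_of_rightRows` (any torus Wilson theory) — if `φ` is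
  level-`W` feasible, satisfies the RIGHT rows on `V ⊆ W`, and `V` is `Θ'`-stable, then `φ ∘ Θ'^*`
  is level-`V` feasible;
* ★★★ `isBootstrapFeasible_comp_negReflect_suN` — `SU(N)`: level-`(n+2)` feasible ⇒ the reflected
  functional is level-`n` feasible;
* ★★★ `levelValues_succ_succ_subset_reflSymLevelValues_suN`, `reflSym_bounds_sandwich_suN` — for a
  `Θ'`-invariant objective `P`: `levelValues_{n+2}(P) ⊆ symLevelValues_n({Θ'}, P) ⊆ levelValues_n(P)`;
  so the reflection-cut level-`n` SDP bound lies between the plain level-`n` and the plain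
  level-`(n+2)` bounds: imposing reflection invariance at a fixed level gains AT MOST what two more
  levels of words gain.

What this is NOT: whether the reflection cut gains anything at all at fixed level (strictness of
either inclusion is not claimed); reflection POSITIVITY cuts (ADDENDUM 5/8) are a different matter.

References: K. Gatermann, P. A. Parrilo (2004) §3; V. Kazakov, Z. Zheng, arXiv:2203.11360 §3.2.
Folklore.
-/

noncomputable section

open MeasureTheory Filter Topology NormedSpace
open Literature.MathematicalPhysics.QuantumFieldTheory (LatticeRep Site Edge GaugeConfig wilsonAction
  wilsonMeasure isProbabilityMeasure_wilsonMeasure wilsonAction_negReflect_eq)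
open Literature.MathematicalPhysics.QuantumLattice

namespace Summit.QuantumFields.GaugeBoot

/-! ## The word truncation is reflection stable -/

section Words

variable {d L : ℕ} [NeZero d] {G : Type*} [Group G] [TopologicalSpace G] [IsTopologicalGroup G]
  (r : LatticeRep G)

/-- A generator composed with the reflection is `±` a generator. -/
theorem comp_negReflectCM_entryGens {x : C(GaugeConfig d L G, ℝ)} (hx : x ∈ entryGens (ι := Edge d L) r) :
    ∃ y ∈ entryGens (ι := Edge d L) r, x.comp negReflectCM = y ∨ x.comp negReflectCM = -y := by
  rcases hx with ⟨⟨e, a, b⟩, rfl⟩ | ⟨⟨e, a, b⟩, rfl⟩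
  · by_cases he : e.2 = 0
    · refine ⟨reEntry r (((e.1.shift 0).negReflect, 0) : Edge d L) b a,
        Or.inl ⟨(((e.1.shift 0).negReflect, 0), b, a), rfl⟩, Or.inl ?_⟩
      ext U
      simp only [ContinuousMap.comp_apply, negReflectCM_apply, reEntry_apply, GaugeConfig.negReflect, he,
        if_true]
      exact (rho_inv_apply_re_im r _ a b).1
    · refine ⟨reEntry r ((e.1.negReflect, e.2) : Edge d L) a b,
        Or.inl ⟨((e.1.negReflect, e.2), a, b), rfl⟩, Or.inl ?_⟩
      ext U
      simp only [ContinuousMap.comp_apply, negReflectCM_apply, reEntry_apply, GaugeConfig.negReflect, he,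
        if_false]
  · by_cases he : e.2 = 0
    · refine ⟨imEntry r (((e.1.shift 0).negReflect, 0) : Edge d L) b a,
        Or.inr ⟨(((e.1.shift 0).negReflect, 0), b, a), rfl⟩, Or.inr ?_⟩
      ext U
      simp only [ContinuousMap.comp_apply, negReflectCM_apply, imEntry_apply, GaugeConfig.negReflect, he,
        if_true, ContinuousMap.neg_apply]
      exact (rho_inv_apply_re_im r _ a b).2
    · refine ⟨imEntry r ((e.1.negReflect, e.2) : Edge d L) a b,
        Or.inr ⟨((e.1.negReflect, e.2), a, b), rfl⟩, Or.inl ?_⟩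
      ext U
      simp only [ContinuousMap.comp_apply, negReflectCM_apply, imEntry_apply, GaugeConfig.negReflect, he,
        if_false]

/-- A word of length `≤ n` composed with the reflection is `±` a word of length `≤ n`. -/
theorem comp_negReflectCM_wordsUpTo {n : ℕ} {w : C(GaugeConfig d L G, ℝ)} (hw : w ∈ wordsUpTo (ι := Edge d L) r n) :
    ∃ w' ∈ wordsUpTo (ι := Edge d L) r n, w.comp negReflectCM = w' ∨ w.comp negReflectCM = -w' := by
  obtain ⟨l, hl, hlen, rfl⟩ := hw
  induction l generalizing n with
  | nil => exact ⟨1, ⟨[], by simp, by simp, by simp⟩, Or.inl (by ext U; rfl)⟩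
  | cons x l ih =>
    obtain ⟨y, hy, hxy⟩ := comp_negReflectCM_entryGens r (hl x List.mem_cons_self)
    obtain ⟨w', hw', hlw'⟩ := ih (n := l.length) (fun z hz => hl z (List.mem_cons_of_mem x hz)) le_rfl
    obtain ⟨l', hl', hl'len, rfl⟩ := hw'
    have hmem : (y :: l').prod ∈ wordsUpTo (ι := Edge d L) r n :=
      ⟨y :: l', fun z hz => by
        rcases List.mem_cons.1 hz with rfl | hz
        · exact hy
        · exact hl' z hz, by simp at hlen ⊢; omega, rfl⟩
    refine ⟨(y :: l').prod, hmem, ?_⟩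
    have hprod : ((x :: l).prod).comp (negReflectCM (G := G) (d := d) (L := L)) =
        x.comp negReflectCM * (l.prod).comp negReflectCM := by
      rw [List.prod_cons]; rfl
    rw [hprod, List.prod_cons]
    rcases hxy with h1 | h1 <;> rcases hlw' with h2 | h2 <;> rw [h1, h2]
    · exact Or.inl rfl
    · exact Or.inr (by rw [mul_neg])
    · exact Or.inr (by rw [neg_mul])
    · exact Or.inl (by rw [neg_mul_neg])

/-- ★ **The word truncation is reflection stable.** -/
theorem comp_negReflectCM_mem_wordTruncation {n : ℕ} {v : C(GaugeConfig d L G, ℝ)}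
    (hv : v ∈ wordTruncation (ι := Edge d L) r n) : v.comp negReflectCM ∈ wordTruncation (ι := Edge d L) r n := by
  have h : Submodule.span ℝ (wordsUpTo (ι := Edge d L) r n) ≤
      (Submodule.span ℝ (wordsUpTo (ι := Edge d L) r n)).comap
        (ContinuousMap.compRightAlgHom ℝ ℝ (negReflectCM (G := G) (d := d) (L := L))).toLinearMap := by
    refine Submodule.span_le.2 fun w hw => ?_
    obtain ⟨w', hw', h⟩ := comp_negReflectCM_wordsUpTo r hw
    change w.comp negReflectCM ∈ Submodule.span ℝ (wordsUpTo (ι := Edge d L) r n)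
    rcases h with h | h <;> rw [h]
    · exact Submodule.subset_span hw'
    · exact Submodule.neg_mem _ (Submodule.subset_span hw')
  exact h hv

end Words

/-! ## Reflecting a truncated solution -/

section Reflect

variable {d L : ℕ} [NeZero d] [NeZero L] {G : Type*} [Group G] [TopologicalSpace G]
  [IsTopologicalGroup G] [CompactSpace G] (r : LatticeRep G) {N : ℕ} (ρ : G →* Matrix (Fin N) (Fin N) ℂ)
  {K : Type*} {k : K → ℝ → G} {β : ℝ}

/-- ★★ **Reflecting a truncated solution** (truncated form of `IsSDFunctional.comp_negReflect`): if
`φ` is level-`W` feasible for the torus Wilson rows, satisfies the RIGHT rows on `V ⊆ W` (these carry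
the rows of the reversed links), and `V` is reflection stable, then `φ ∘ Θ'^*` is level-`V`
feasible. [folklore] -/
theorem IsBootstrapFeasible.comp_negReflect_of_rightRows (hρ : Continuous ρ)
    (hk : ∀ a s t, k a (s + t) = k a s * k a t) {V W : Set C(GaugeConfig d L G, ℝ)} (hVW : V ⊆ W)
    (hVΘ : ∀ v ∈ V, v.comp (negReflectCM (G := G) (d := d) (L := L)) ∈ V)
    {φ : C(GaugeConfig d L G, ℝ) →ₗ[ℝ] ℝ}
    (hφ : IsBootstrapFeasible r k (fun _ : Edge d L => wilsonAction ρ) β W φ)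
    (hφR : IsRightRowsOn r k (fun _ : Edge d L => wilsonAction ρ) β V φ) :
    IsBootstrapFeasible r k (fun _ : Edge d L => wilsonAction ρ) β V
      (φ ∘ₗ (ContinuousMap.compRightAlgHom ℝ ℝ (negReflectCM (G := G) (d := d) (L := L))).toLinearMap) := by
  refine ⟨?_, fun v hv => ?_, fun i a => ?_⟩
  · change φ ((1 : C(GaugeConfig d L G, ℝ)).comp negReflectCM) = 1
    exact hφ.1
  · change 0 ≤ φ ((v * v).comp negReflectCM)
    exact hφ.2.1 _ (hVW (hVΘ v hv))
  obtain ⟨S', hS'm, hS', -⟩ := hφ.2.2 i a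
  refine ⟨S', hS'm, hS', fun f hf f' hf'm hf' => ?_⟩
  change φ (f'.comp negReflectCM) = β * φ ((f * S').comp negReflectCM)
  by_cases hi : i.2 = 0
  · -- reversed link: the right row at `θ i` for the test function `f ∘ Θ' ∈ V`
    obtain ⟨SR, hSRm, hSR, hrowR⟩ := hφR (reflEdge i) a
    have hflip : ∀ (h : GaugeConfig d L G → ℝ) (U : GaugeConfig d L G),
        (fun t => h (GaugeConfig.negReflect (Function.update U (reflEdge i) (U (reflEdge i) * k a t)))) =
          fun t => h (Function.update (GaugeConfig.negReflect U) i (k a (-t) * GaugeConfig.negReflect U i)) := fun h U => by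
      funext t
      rw [← negReflect_update_reversed U hi, ← oneParam_neg (hk a), neg_neg]
    have hF' : ∀ U, HasDerivAt (fun t => (f.comp negReflectCM) (Function.update U (reflEdge i) (U (reflEdge i) * k a t)))
        ((-(f'.comp negReflectCM)) U) 0 := fun U => by
      simp only [ContinuousMap.comp_apply, negReflectCM_apply, ContinuousMap.neg_apply]
      rw [hflip]
      exact hasDerivAt_comp_neg_zero (hf' (GaugeConfig.negReflect U))
    have hSR' : ∀ U, SR U = -S' (GaugeConfig.negReflect U) := fun U => by
      have h1 := hSR U
      have h3 : HasDerivAt (fun t => wilsonAction ρ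
          (Function.update U (reflEdge i) (U (reflEdge i) * k a t))) (-S' (GaugeConfig.negReflect U)) 0 := by
        have hfun : (fun t => wilsonAction ρ (Function.update U (reflEdge i) (U (reflEdge i) * k a t))) =
            fun t => wilsonAction ρ (GaugeConfig.negReflect (Function.update U (reflEdge i) (U (reflEdge i) * k a t))) := by
          funext t; rw [wilsonAction_negReflect_eq ρ hρ]
        rw [hfun, hflip]
        exact hasDerivAt_comp_neg_zero (hS' (GaugeConfig.negReflect U))
      exact h1.unique h3
    have hrow := hrowR (f.comp negReflectCM) (hVΘ f hf) (-(f'.comp negReflectCM))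
      (Subalgebra.neg_mem _ (comp_negReflectCM_mem_polyAlgebra r hf'm)) hF'
    have hprod : f.comp negReflectCM * SR = -((f * S').comp (negReflectCM (G := G) (d := d) (L := L))) := by
      ext U
      simp [hSR']
    rw [map_neg, hprod, map_neg] at hrow
    linarith
  · -- carried link: the left row at `θ i` for the test function `f ∘ Θ' ∈ V ⊆ W`
    obtain ⟨S₂, hS₂m, hS₂, hrow₂⟩ := hφ.2.2 (reflEdge i) a
    have hflip : ∀ (h : GaugeConfig d L G → ℝ) (U : GaugeConfig d L G),
        (fun t => h (GaugeConfig.negReflect (Function.update U (reflEdge i) (k a t * U (reflEdge i))))) =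
          fun t => h (Function.update (GaugeConfig.negReflect U) i (k a t * GaugeConfig.negReflect U i)) := fun h U => by
      funext t
      rw [negReflect_update_carried U hi]
    have hF' : ∀ U, HasDerivAt (fun t => (f.comp negReflectCM) (Function.update U (reflEdge i) (k a t * U (reflEdge i))))
        ((f'.comp negReflectCM) U) 0 := fun U => by
      simp only [ContinuousMap.comp_apply, negReflectCM_apply]
      rw [hflip]
      exact hf' (GaugeConfig.negReflect U)
    have hS₂' : ∀ U, S₂ U = S' (GaugeConfig.negReflect U) := fun U => by
      have h3 : HasDerivAt (fun t => wilsonAction ρ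
          (Function.update U (reflEdge i) (k a t * U (reflEdge i)))) (S' (GaugeConfig.negReflect U)) 0 := by
        have hfun : (fun t => wilsonAction ρ (Function.update U (reflEdge i) (k a t * U (reflEdge i)))) =
            fun t => wilsonAction ρ (GaugeConfig.negReflect (Function.update U (reflEdge i) (k a t * U (reflEdge i)))) := by
          funext t; rw [wilsonAction_negReflect_eq ρ hρ]
        rw [hfun, hflip]
        exact hS' (GaugeConfig.negReflect U)
      exact (hS₂ U).unique h3
    have hrow := hrow₂ (f.comp negReflectCM) (hVW (hVΘ f hf)) (f'.comp negReflectCM)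
      (comp_negReflectCM_mem_polyAlgebra r hf'm) hF'
    have hprod : f.comp negReflectCM * S₂ = (f * S').comp (negReflectCM (G := G) (d := d) (L := L)) := by
      ext U
      simp [hS₂']
    rwa [hprod] at hrow

end Reflect

/-! ## `SU(N)`: the sandwich -/

section SuN

variable {d L : ℕ} [NeZero d] [NeZero L] (N : ℕ) (β : ℝ) (n : ℕ)

/-- ★★★ **`SU(N)`: a level-`(n+2)` solution reflected is a level-`n` solution** (any `β`, any
torus). [folklore] -/
theorem isBootstrapFeasible_comp_negReflect_suN
    {φ : C(GaugeConfig d L (Matrix.specialUnitaryGroup (Fin N) ℂ), ℝ) →ₗ[ℝ] ℝ}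
    (hφ : IsBootstrapFeasible (fundamentalLatticeRep N) (suExp N)
      (fun _ => wilsonAction (fundamentalRep (Fin N))) β
      (wordTruncation (ι := Edge d L) (fundamentalLatticeRep N) (n + 2)) φ) :
    IsBootstrapFeasible (fundamentalLatticeRep N) (suExp N)
      (fun _ => wilsonAction (fundamentalRep (Fin N))) β
      (wordTruncation (ι := Edge d L) (fundamentalLatticeRep N) n)
      (φ ∘ₗ (ContinuousMap.compRightAlgHom ℝ ℝ
        (negReflectCM (G := Matrix.specialUnitaryGroup (Fin N) ℂ) (d := d) (L := L))).toLinearMap) :=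
  hφ.comp_negReflect_of_rightRows (fundamentalLatticeRep N) (fundamentalRep (Fin N))
    (continuous_fundamentalRep _) (suExp_add N) (wordTruncation_mono _ (by omega))
    (fun v hv => comp_negReflectCM_mem_wordTruncation (fundamentalLatticeRep N) hv)
    (isRightRowsOn_of_isBootstrapFeasible_suN N
      (fun _ => wilsonAction_mem_polyFunctions (fundamentalLatticeRep N)) hφ)

/-- ★★★ **Reflection cuts cost at most two levels.** `SU(N)` on the torus, any `β`, `P` a
reflection-invariant objective: every level-`(n+2)` feasible value of `P` is a value of the
level-`n` SDP WITH reflection invariance imposed (average of a level-`(n+2)` solution and its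
reflection). [folklore] -/
theorem levelValues_succ_succ_subset_reflSymLevelValues_suN
    {P : C(GaugeConfig d L (Matrix.specialUnitaryGroup (Fin N) ℂ), ℝ)}
    (hP : P.comp (negReflectCM (G := Matrix.specialUnitaryGroup (Fin N) ℂ) (d := d) (L := L)) = P) :
    levelValuesSuN (d := d) (L := L) N β (n + 2) P ⊆
      symLevelValuesSuN (d := d) (L := L) N β n {negReflectCM} P := by
  rintro t ⟨φ, hφ, rfl⟩
  set Θ := (ContinuousMap.compRightAlgHom ℝ ℝ
    (negReflectCM (G := Matrix.specialUnitaryGroup (Fin N) ℂ) (d := d) (L := L))).toLinearMap with hΘ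
  have hφ₁ : IsBootstrapFeasible (fundamentalLatticeRep N) (suExp N)
      (fun _ => wilsonAction (fundamentalRep (Fin N))) β
      (wordTruncation (ι := Edge d L) (fundamentalLatticeRep N) n) φ :=
    hφ.mono _ (wordTruncation_mono _ (by omega))
  have hφ₂ := isBootstrapFeasible_comp_negReflect_suN N β n hφ
  -- the average of `φ` and its reflection
  set ψ : C(GaugeConfig d L (Matrix.specialUnitaryGroup (Fin N) ℂ), ℝ) →ₗ[ℝ] ℝ :=
    (1 / 2 : ℝ) • φ + (1 / 2 : ℝ) • (φ ∘ₗ Θ) with hψ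
  have hψfeas : IsBootstrapFeasible (fundamentalLatticeRep N) (suExp N)
      (fun _ => wilsonAction (fundamentalRep (Fin N))) β
      (wordTruncation (ι := Edge d L) (fundamentalLatticeRep N) n) ψ := by
    have h := isBootstrapFeasible_sum_smul (fundamentalLatticeRep N) (Γ := Bool) (k := suExp N)
      (S := fun _ : Edge d L => wilsonAction (fundamentalRep (Fin N))) (β := β)
      (V := wordTruncation (ι := Edge d L) (fundamentalLatticeRep N) n)
      (fun _ => (1 / 2 : ℝ)) (fun _ => by norm_num) (by simp)
      (fun b => if b then φ else φ ∘ₗ Θ) (fun b => by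
        cases b
        · exact hφ₂
        · exact hφ₁)
    have he : (∑ b : Bool, (1 / 2 : ℝ) • (if b then φ else φ ∘ₗ Θ)) = ψ := by
      rw [Fintype.sum_bool, hψ]; simp
    rwa [he] at h
  have hinvol : ∀ v : C(GaugeConfig d L (Matrix.specialUnitaryGroup (Fin N) ℂ), ℝ),
      (v.comp negReflectCM).comp (negReflectCM (G := Matrix.specialUnitaryGroup (Fin N) ℂ) (d := d) (L := L)) = v := by
    intro v; ext U
    simp only [ContinuousMap.comp_apply, negReflectCM_apply,
      Literature.MathematicalPhysics.QuantumFieldTheory.WilsonSiteRP.negReflect_negReflect_config]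
  refine ⟨ψ, hψfeas, ?_, ?_⟩
  · rintro R hR v -
    rw [Set.mem_singleton_iff.1 hR]
    simp only [hψ, LinearMap.add_apply, LinearMap.smul_apply, LinearMap.coe_comp, Function.comp_apply]
    change (1 / 2 : ℝ) • φ (v.comp negReflectCM) + (1 / 2 : ℝ) • φ ((v.comp negReflectCM).comp negReflectCM) =
      (1 / 2 : ℝ) • φ v + (1 / 2 : ℝ) • φ (v.comp negReflectCM)
    rw [hinvol, add_comm]
  · simp only [hψ, LinearMap.add_apply, LinearMap.smul_apply, LinearMap.coe_comp, Function.comp_apply]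
    change (1 / 2 : ℝ) • φ P + (1 / 2 : ℝ) • φ (P.comp negReflectCM) = φ P
    rw [hP, smul_eq_mul]
    ring

/-- ★★★ **The sandwich**: for a reflection-invariant objective the level-`n` SDP bounds WITH the
reflection cut lie between the plain level-`n` and the plain level-`(n+2)` bounds
(`levelValues_{n+2} ⊆ reflSym_n ⊆ levelValues_n`). [folklore] -/
theorem reflSym_sandwich_suN
    {P : C(GaugeConfig d L (Matrix.specialUnitaryGroup (Fin N) ℂ), ℝ)}
    (hP : P.comp (negReflectCM (G := Matrix.specialUnitaryGroup (Fin N) ℂ) (d := d) (L := L)) = P) :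
    levelValuesSuN (d := d) (L := L) N β (n + 2) P ⊆
        symLevelValuesSuN (d := d) (L := L) N β n {negReflectCM} P ∧
      symLevelValuesSuN (d := d) (L := L) N β n {negReflectCM} P ⊆
        levelValuesSuN (d := d) (L := L) N β n P :=
  ⟨levelValues_succ_succ_subset_reflSymLevelValues_suN N β n hP,
    symLevelValues_subset_levelValues N β n _ P⟩

/-- **Bounds form of the sandwich** (for `P` in the level-`n` certificate domain, where all three
value sets are bounded intervals): `hi_{n+2}(P) ≤ hi^{refl}_n(P) ≤ hi_n(P)`. [folklore] -/
theorem csSup_reflSym_sandwich_suN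
    {P : C(GaugeConfig d L (Matrix.specialUnitaryGroup (Fin N) ℂ), ℝ)}
    (hP : P.comp (negReflectCM (G := Matrix.specialUnitaryGroup (Fin N) ℂ) (d := d) (L := L)) = P)
    (hbdd : BddAbove (levelValuesSuN (d := d) (L := L) N β n P))
    (hne : (levelValuesSuN (d := d) (L := L) N β (n + 2) P).Nonempty) :
    sSup (levelValuesSuN (d := d) (L := L) N β (n + 2) P) ≤
        sSup (symLevelValuesSuN (d := d) (L := L) N β n {negReflectCM} P) ∧
      sSup (symLevelValuesSuN (d := d) (L := L) N β n {negReflectCM} P) ≤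
        sSup (levelValuesSuN (d := d) (L := L) N β n P) := by
  obtain ⟨h1, h2⟩ := reflSym_sandwich_suN N β n hP
  exact ⟨csSup_le_csSup (hbdd.mono h2) hne h1, csSup_le_csSup hbdd (hne.mono h1) h2⟩

end SuN

end Summit.QuantumFields.GaugeBoot

end
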